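import Summits.HodgeConjecture.HodgeConjecture.Theorems.Q8MonodromyBireflectionLocalConfiguration
import Summits.HodgeConjecture.HodgeConjecture.Theses.Q8SymplecticPowers
import Literature.AlgebraicGeometry.Motives.Varieties
import Literature.AlgebraicGeometry.Motives.Sweep1
import Literature.AlgebraicGeometry.Motives.HodgeTensor
import Literature.AlgebraicGeometry.Motives.HodgeTensorFactsHolds
import Literature.AlgebraicGeometry.Motives.FamiliesVHS
import Literature.AlgebraicGeometry.HodgeTheory.HodgeConjecture
import Literature.AlgebraicGeometry.HodgeTheory.BettiUniverseAxioms
import Literature.AlgebraicGeometry.HodgeTheory.ComplexConjugationHolds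
import Literature.AlgebraicGeometry.HodgeTheory.LefschetzOneOne
import Literature.AlgebraicGeometry.HodgeTheory.AlgebraicMonodromyMumfordTate
import Literature.AlgebraicGeometry.HodgeTheory.FibrewiseDeckRelations
import Literature.AlgebraicGeometry.HodgeTheory.QuaternionicQuarticCover
import Literature.AlgebraicGeometry.HodgeTheory.QuaternionicQuarticFamily
import Literature.AlgebraicGeometry.HodgeTheory.QuaternionicQuarticDeckChart
import Literature.AlgebraicGeometry.HodgeTheory.QuaternionicQuarticDeckChartAction
import Literature.Algebra.Lie.KatzRecognitionTheorems
import Literature.Algebra.Lie.KatzRecognitionAddenda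
import Literature.AlgebraicGeometry.HodgeTheory.DeligneMonodromySemisimple
import Literature.AlgebraicGeometry.HodgeTheory.MonodromySemisimpleSubvariations
import Literature.AlgebraicGeometry.Resolution.FunctorialResolutionAutomorphisms
import HarnessLib

/-!
# Route Q8SymplecticPowers — objects the LOC6 line of crux K1Q posits (definitions): stub S5 by name and its geometric input

Sub-problem `HodgeConjecture`, route `Summits/HodgeConjecture/HodgeConjecture/Theses/Q8SymplecticPowers.lean`, crux K1Q
`VeryGeneralQuaternionCommutatorsInHg` (stmt-HodgeConjecture-24190), skeleton v6 (`Cruxes/…/K1Q_mechanism_v6.lean`, cell bus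
`p3/routeC-g37/`). Written by the prover seat `hodge-nonav-prover-Ax` (g18). Theorems files cannot import the crux workfile, so the
registered stub S5 `stub_monodromyBireflectionQ` is restated here BY NAME, VERBATIM (`MonodromyBireflectionQ`), together with the ONE
geometric input it has been reduced to by the landed chain `Q8MonodromyBireflection{Assembly,AssemblyKer,Transport,LocalConfiguration,
LocalConfigurationMV}` + `Literature…{PhamBrieskornA3*, HomologyTwoPiecesKernelDatum, MayerVietorisKernelPart, BettiTraceFormDisjointCarriers,
ComplexPointsPoincareDuality}`: `GeometricMonodromyDatumQ` — at ONE point of the base, the geometric monodromy of a d6 meridian (a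
homeomorphism realising a monodromy transformation non-trivial on `ker(A² + 1)`, supported in two `τ`-stable balls exchanged by `j`,
commuting with `τ`) together with the Mayer–Vietoris description of the two ball pieces (memo `LOC6-ARCHITECTURE-Ax-g18.md` §8 (G)).
`Theorems/Q8MonodromyBireflectionQOfGeometricDatum.lean` proves `GeometricMonodromyDatumQ → MonodromyBireflectionQ`.

These are route-posited STATEMENTS (hypothesis/target shapes), not results; HC ∕ HC_AV ∕ K1Q are NOT proved here.
-/

noncomputable section

set_option linter.dupNamespace false

attribute [local instance] Literature.AlgebraicTopology.SingularHomology.OrbitSpace.homeoMulAction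

namespace Summit.HodgeConjecture.HodgeConjecture.Theorems.Q8SymplecticPowersLoc6Defs

open CategoryTheory CategoryTheory.Limits Set
open Literature.AlgebraicTopology.SingularHomology Literature.AlgebraicGeometry Literature.AlgebraicGeometry.Motives
open Literature.AlgebraicGeometry.HodgeTheory Literature.AlgebraicGeometry.HodgeTheory.BettiUniverse
open Literature.Geometry.ComplexAnalytic Literature.Geometry.ComplexAnalytic.PhamBrieskorn

/-- **Stub S5 of skeleton v6 of crux K1Q, by name** (`stub_monodromyBireflectionQ`, VERBATIM): for the quaternionic quartic deck family, at
every base point some monodromy transformation is a "bireflection pair" on `ker(A² + 1) ⊗ ℂ` (eigenlines `ℓ₊, ℓ₋` of `A` with `Qf(ℓ₊, Bℓ₋) ≠ 0`,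
`γ = i` on `ℓ₊`, `−i` on `ℓ₋`, identity on the `Qf(·, Bℓ_±)`-orthogonal part of the `i`-eigenspace). -/
def MonodromyBireflectionQ : Prop :=
    open Literature.AlgebraicGeometry.Motives Literature.AlgebraicGeometry.HodgeTheory Literature.AlgebraicGeometry.HodgeTheory.BettiUniverse Literature.AlgebraicGeometry.HodgeTheory.Q8Family Literature.AlgebraicGeometry.RelativeSpec Literature.AlgebraicGeometry.RelativeSpec.ActionOver Literature.Algebra.Lie Literature.Algebra.Lie.KatzRecognition CategoryTheory CategoryTheory.Limits MonoidalCategory CartesianMonoidalCategory AlgebraicGeometry in ∀ ⦃e : ℕ⦄, Even e → 4 ≤ e → ∀ (W : (Spec (.of (ParamRing e))).Opens) (𝒳 : SchemeOver ℂ) (π : 𝒳 ⟶ base W) (τ j : 𝒳 ⟶ 𝒳) (ι : (deckChart (fun i => (MvPolynomial.X i : ParamRing e)) ⊗ Over.mk W.ι).left ⟶ 𝒳.left), Nonempty (ComplexPoints (base W)) → ∀ (hπ : IsSmoothProjectiveFamily π 2), IsQuasiProjectiveOver 𝒳 → IsQuasiProjectiveOver (base W) → AlgebraicGeometry.SmoothOfRelativeDimension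 (Fintype.card (CIdx e)) (base W).hom → ∀ (hτπ : τ ≫ π = π) (hjπ : j ≫ π = π), τ ≫ τ ≫ τ ≫ τ = 𝟙 𝒳 → j ≫ j = τ ≫ τ → τ ≫ j ≫ τ = j → IsOpenImmersion ι → ι ≫ π.left = (snd (deckChart (fun i => (MvPolynomial.X i : ParamRing e))) (Over.mk W.ι)).left → ((Over.isoMk ((deckAction (fun i => (MvPolynomial.X i : ParamRing e))).aut (QuaternionGroup.a 1)) ((deckAction (fun i => (MvPolynomial.X i : ParamRing e))).aut_comp (QuaternionGroup.a 1))).hom ▷ Over.mk W.ι).left ≫ ι = ι ≫ τ.left → ((Over.isoMk ((deckAction (fun i => (MvPolynomial.X i : ParamRing e))).aut (QuaternionGroup.xa 0)) ((deckAction (fun i => (MvPolynomial.X i : ParamRing e))).aut_comp (QuaternionGroup.xa 0))).hom ▷ Over.mk W.ι).left ≫ ι = ι ≫ j.left → Function.Surjective (snd (deckChart (fun i => (MvPolynomial.X i : ParamRing e))) (Over.mk W.ι)).left → ∀ (hU : IsCohomologicallyLocallyTrivialOn π Set.univ) (s : ComplexPoints (base W)), let Xs := fiberOver π s; let hXs :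 IsSmoothProjective 2 Xs := hπ.isSmoothProjective s; let A : bettiCohomology Xs 2 →ₗ[ℚ] bettiCohomology Xs 2 := pull (fiberOverEnd π τ hτπ s) 2; let B : bettiCohomology Xs 2 →ₗ[ℚ] bettiCohomology Xs 2 := pull (fiberOverEnd π j hjπ s) 2; let Qf : LinearMap.BilinForm ℚ (bettiCohomology Xs 2) := LinearMap.compr₂ (cup Xs 2 2) (tr hXs (2 + 2)); let Γ := ratMonodromyGroup π 2 hU ⟨s, Set.mem_univ s⟩; ∃ γ ∈ Γ, ∃ ℓp ℓm : TensorProduct ℚ ℂ (bettiCohomology Xs 2), ℓp ∈ (Module.End.eigenspace (A ^ 2) (-1)).baseChange ℂ ∧ ℓm ∈ (Module.End.eigenspace (A ^ 2) (-1)).baseChange ℂ ∧ A.baseChange ℂ ℓp = Complex.I • ℓp ∧ A.baseChange ℂ ℓm = Complex.I • ℓm ∧ (Qf.baseChange ℂ) ℓp (B.baseChange ℂ ℓm) ≠ 0 ∧ (γ.toLinearMap.baseChange ℂ) ℓp = Complex.I • ℓp ∧ (γ.toLinearMap.baseChange ℂ) ℓm = (-Complex.I) • ℓm ∧ ∀ x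 ∈ (Module.End.eigenspace (A ^ 2) (-1)).baseChange ℂ, A.baseChange ℂ x = Complex.I • x → (Qf.baseChange ℂ) x (B.baseChange ℂ ℓp) = 0 → (Qf.baseChange ℂ) x (B.baseChange ℂ ℓm) = 0 → (γ.toLinearMap.baseChange ℂ) x = x

/-- **The geometric monodromy datum of a d6 meridian at a base point `s`** (the residual input of S5-v6, memo LOC6 §8 (G)), for a family
`π` with deck pair `τ, j` over the base: a monodromy transformation `γ ∈ Γ_s`, non-trivial on `ker(A² + 1)`, realised by a homeomorphism `h`
of `X_s(ℂ)` (`h^* = γ`, `h_*[X_s] = [X_s]`, `h τ = τ h`) which is the identity on an open `B` and preserves two open pieces `A₁, A₂`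
(`A₁ ∪ A₂ ∪ B = X_s(ℂ)`, `closure A₁ ∩ A₂ = ∅`, `τ`-stable, exchanged by `j`), each covered by `U_k ∪ V_k` with `H₁ = H₂ = 0` of
`U_k ∩ V_k` over `ℚ`, `τ² = +1` on the finite-dimensional `H₂(V_k; ℚ)`, and `U_k` modelled ON HOMOLOGY on the free quotient `F°∕ι` of the
punctured `A₃` Milnor fibre (`(e₁ ∘ h)_* = (h̄ ∘ e₁)_*`, `(e₁ ∘ τ)_* = (τ̄ ∘ e₁)_*`, `(e₂ ∘ h)_* = (h̄ ∘ e₂)_*`, `(e₂ ∘ τ³)_* = (τ̄ ∘ e₂)_*`). -/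
structure GeometricMonodromyDatum {𝒳 S : SchemeOver ℂ} (π : 𝒳 ⟶ S) {τ j : 𝒳 ⟶ 𝒳} (hτπ : τ ≫ π = π) (hjπ : j ≫ π = π)
    (hπ : IsSmoothProjectiveFamily π 2) (hU : IsCohomologicallyLocallyTrivialOn π (Set.univ : Set (ComplexPoints S)))
    (s : ComplexPoints S) where
  ζ : ℂ
  hζ : IsPrimitiveRoot ζ 4
  γ : bettiCohomology (fiberOver π s) 2 ≃ₗ[ℚ] bettiCohomology (fiberOver π s) 2
  hγΓ : γ ∈ ratMonodromyGroup π 2 hU ⟨s, Set.mem_univ s⟩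
  hγ1 : ∃ a, pull (fiberOverEnd π τ hτπ s) 2 (pull (fiberOverEnd π τ hτπ s) 2 a) = -a ∧ γ a ≠ a
  h : ComplexPoints (fiberOver π s) ≃ₜ ComplexPoints (fiberOver π s)
  hγh : ∀ a, γ a = (singularCohomology.map ℚ ℚ (h : C(ComplexPoints (fiberOver π s), ComplexPoints (fiberOver π s))) 2).hom a
  hhμ : singularHomology.map ℚ ℚ (h : C(ComplexPoints (fiberOver π s), ComplexPoints (fiberOver π s))) 4
    (complexOrientationRat (hπ.isSmoothProjective s)).fundamentalClass = (complexOrientationRat (hπ.isSmoothProjective s)).fundamentalClass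
  hhτ : ∀ x, h (AlgPoints.mapContinuous (L := ℂ) (fiberOverEnd π τ hτπ s) x) = AlgPoints.mapContinuous (L := ℂ) (fiberOverEnd π τ hτπ s) (h x)
  A₁ : Set (ComplexPoints (fiberOver π s))
  A₂ : Set (ComplexPoints (fiberOver π s))
  B : Set (ComplexPoints (fiberOver π s))
  h1o : IsOpen A₁
  h2o : IsOpen A₂
  hBo : IsOpen B
  hcov : A₁ ∪ A₂ ∪ B = univ
  hdisj : Disjoint (closure A₁) A₂
  hB : ∀ x ∈ B, h x = x
  hhA₁ : MapsTo (h : C(ComplexPoints (fiberOver π s), ComplexPoints (fiberOver π s))) A₁ A₁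
  hhA₂ : MapsTo (h : C(ComplexPoints (fiberOver π s), ComplexPoints (fiberOver π s))) A₂ A₂
  hτA₁ : MapsTo (AlgPoints.mapContinuous (L := ℂ) (fiberOverEnd π τ hτπ s)) A₁ A₁
  hτA₂ : MapsTo (AlgPoints.mapContinuous (L := ℂ) (fiberOverEnd π τ hτπ s)) A₂ A₂
  hjA₁ : MapsTo (AlgPoints.mapContinuous (L := ℂ) (fiberOverEnd π j hjπ s)) A₁ A₂
  hjA₂ : MapsTo (AlgPoints.mapContinuous (L := ℂ) (fiberOverEnd π j hjπ s)) A₂ A₁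
  U₁ : Set ↥A₁
  V₁ : Set ↥A₁
  hUo₁ : IsOpen U₁
  hVo₁ : IsOpen V₁
  hUV₁ : U₁ ∪ V₁ = univ
  hI₁₁ : IsZero (singularHomology ℚ ℚ ↥(U₁ ∩ V₁) 2)
  hI₀₁ : IsZero (singularHomology ℚ ℚ ↥(U₁ ∩ V₁) 1)
  hsU₁ : MapsTo (singularHomology.restrictSelf (AlgPoints.mapContinuous (L := ℂ) (fiberOverEnd π τ hτπ s)) hτA₁) U₁ U₁
  hsV₁ : MapsTo (singularHomology.restrictSelf (AlgPoints.mapContinuous (L := ℂ) (fiberOverEnd π τ hτπ s)) hτA₁) V₁ V₁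
  hgU₁ : MapsTo (singularHomology.restrictSelf (h : C(ComplexPoints (fiberOver π s), ComplexPoints (fiberOver π s))) hhA₁) U₁ U₁
  hfinV₁ : Module.Finite ℚ (singularHomology ℚ ℚ (↥V₁) 2)
  hsV2₁ : ∀ v : singularHomology ℚ ℚ (↥V₁) 2, singularHomology.map ℚ ℚ (singularHomology.restrictSelf (singularHomology.restrictSelf (AlgPoints.mapContinuous (L := ℂ) (fiberOverEnd π τ hτπ s)) hτA₁) hsV₁) 2
    (singularHomology.map ℚ ℚ (singularHomology.restrictSelf (singularHomology.restrictSelf (AlgPoints.mapContinuous (L := ℂ) (fiberOverEnd π τ hτπ s)) hτA₁) hsV₁) 2 v) = v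
  e₁ : ↥U₁ ≃ₜ OrbitSpace (iotaPunct 4 four_ne_zero (by decide))
  heg₁ : singularHomology.map ℚ ℚ ((e₁ : C(↥U₁, OrbitSpace (iotaPunct 4 four_ne_zero (by decide)))).comp (singularHomology.restrictSelf (singularHomology.restrictSelf (h : C(ComplexPoints (fiberOver π s), ComplexPoints (fiberOver π s))) hhA₁) hgU₁)) 2 =
    singularHomology.map ℚ ℚ (((OrbitSpace.map (negPairPunct 4 * rotatePunct 4 four_ne_zero ⟨ζ, hζ.pow_eq_one⟩)
    (commute_modelPunct_iotaPunct 4 four_ne_zero (by decide) ⟨ζ, hζ.pow_eq_one⟩)) :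
    C(OrbitSpace (iotaPunct 4 four_ne_zero (by decide)), OrbitSpace (iotaPunct 4 four_ne_zero (by decide)))).comp (e₁ : C(↥U₁, OrbitSpace (iotaPunct 4 four_ne_zero (by decide))))) 2
  hes₁ : singularHomology.map ℚ ℚ ((e₁ : C(↥U₁, OrbitSpace (iotaPunct 4 four_ne_zero (by decide)))).comp (singularHomology.restrictSelf (singularHomology.restrictSelf (AlgPoints.mapContinuous (L := ℂ) (fiberOverEnd π τ hτπ s)) hτA₁) hsU₁)) 2 =
    singularHomology.map ℚ ℚ (((OrbitSpace.map (rotatePunct 4 four_ne_zero ⟨ζ, hζ.pow_eq_one⟩)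
    (commute_rotatePunct_iotaPunct 4 four_ne_zero (by decide) ⟨ζ, hζ.pow_eq_one⟩)) :
    C(OrbitSpace (iotaPunct 4 four_ne_zero (by decide)), OrbitSpace (iotaPunct 4 four_ne_zero (by decide)))).comp (e₁ : C(↥U₁, OrbitSpace (iotaPunct 4 four_ne_zero (by decide))))) 2
  U₂ : Set ↥A₂
  V₂ : Set ↥A₂
  hUo₂ : IsOpen U₂
  hVo₂ : IsOpen V₂
  hUV₂ : U₂ ∪ V₂ = univ
  hI₁₂ : IsZero (singularHomology ℚ ℚ ↥(U₂ ∩ V₂) 2)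
  hI₀₂ : IsZero (singularHomology ℚ ℚ ↥(U₂ ∩ V₂) 1)
  hsU₂ : MapsTo (singularHomology.restrictSelf (AlgPoints.mapContinuous (L := ℂ) (fiberOverEnd π τ hτπ s)) hτA₂) U₂ U₂
  hsV₂ : MapsTo (singularHomology.restrictSelf (AlgPoints.mapContinuous (L := ℂ) (fiberOverEnd π τ hτπ s)) hτA₂) V₂ V₂
  hgU₂ : MapsTo (singularHomology.restrictSelf (h : C(ComplexPoints (fiberOver π s), ComplexPoints (fiberOver π s))) hhA₂) U₂ U₂
  hfinV₂ : Module.Finite ℚ (singularHomology ℚ ℚ (↥V₂) 2)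
  hsV2₂ : ∀ v : singularHomology ℚ ℚ (↥V₂) 2, singularHomology.map ℚ ℚ (singularHomology.restrictSelf (singularHomology.restrictSelf (AlgPoints.mapContinuous (L := ℂ) (fiberOverEnd π τ hτπ s)) hτA₂) hsV₂) 2
    (singularHomology.map ℚ ℚ (singularHomology.restrictSelf (singularHomology.restrictSelf (AlgPoints.mapContinuous (L := ℂ) (fiberOverEnd π τ hτπ s)) hτA₂) hsV₂) 2 v) = v
  e₂ : ↥U₂ ≃ₜ OrbitSpace (iotaPunct 4 four_ne_zero (by decide))
  heg₂ : singularHomology.map ℚ ℚ ((e₂ : C(↥U₂, OrbitSpace (iotaPunct 4 four_ne_zero (by decide)))).comp (singularHomology.restrictSelf (singularHomology.restrictSelf (h : C(ComplexPoints (fiberOver π s), ComplexPoints (fiberOver π s))) hhA₂) hgU₂)) 2 =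
    singularHomology.map ℚ ℚ (((OrbitSpace.map (negPairPunct 4 * rotatePunct 4 four_ne_zero ⟨ζ, hζ.pow_eq_one⟩)
    (commute_modelPunct_iotaPunct 4 four_ne_zero (by decide) ⟨ζ, hζ.pow_eq_one⟩)) :
    C(OrbitSpace (iotaPunct 4 four_ne_zero (by decide)), OrbitSpace (iotaPunct 4 four_ne_zero (by decide)))).comp (e₂ : C(↥U₂, OrbitSpace (iotaPunct 4 four_ne_zero (by decide))))) 2
  hes₂ : singularHomology.map ℚ ℚ ((e₂ : C(↥U₂, OrbitSpace (iotaPunct 4 four_ne_zero (by decide)))).comp ((singularHomology.restrictSelf (singularHomology.restrictSelf (AlgPoints.mapContinuous (L := ℂ) (fiberOverEnd π τ hτπ s)) hτA₂) hsU₂).comp ((singularHomology.restrictSelf (singularHomology.restrictSelf (AlgPoints.mapContinuous (L := ℂ) (fiberOverEnd π τ hτπ s)) hτA₂) hsU₂).comp (singularHomology.restrictSelf (singularHomology.restrictSelf (AlgPoints.mapContinuous (L := ℂ) (fiberOverEnd π τ hτπ s)) hτA₂) hsU₂)))) 2 =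
    singularHomology.map ℚ ℚ (((OrbitSpace.map (rotatePunct 4 four_ne_zero ⟨ζ, hζ.pow_eq_one⟩)
    (commute_rotatePunct_iotaPunct 4 four_ne_zero (by decide) ⟨ζ, hζ.pow_eq_one⟩)) :
    C(OrbitSpace (iotaPunct 4 four_ne_zero (by decide)), OrbitSpace (iotaPunct 4 four_ne_zero (by decide)))).comp (e₂ : C(↥U₂, OrbitSpace (iotaPunct 4 four_ne_zero (by decide))))) 2

/-- **`GeometricMonodromyDatumQ`**: the quaternionic quartic deck family (binders of S5-v6) carries a geometric monodromy datum at SOME base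
point. -/
def GeometricMonodromyDatumQ : Prop :=
    open Literature.AlgebraicGeometry.Motives Literature.AlgebraicGeometry.HodgeTheory Literature.AlgebraicGeometry.HodgeTheory.BettiUniverse Literature.AlgebraicGeometry.HodgeTheory.Q8Family Literature.AlgebraicGeometry.RelativeSpec Literature.AlgebraicGeometry.RelativeSpec.ActionOver Literature.Algebra.Lie Literature.Algebra.Lie.KatzRecognition CategoryTheory CategoryTheory.Limits MonoidalCategory CartesianMonoidalCategory AlgebraicGeometry in ∀ ⦃e : ℕ⦄, Even e → 4 ≤ e → ∀ (W : (Spec (.of (ParamRing e))).Opens) (𝒳 : SchemeOver ℂ) (π : 𝒳 ⟶ base W) (τ j : 𝒳 ⟶ 𝒳) (ι : (deckChart (fun i => (MvPolynomial.X i : ParamRing e)) ⊗ Over.mk W.ι).left ⟶ 𝒳.left), Nonempty (ComplexPoints (base W)) → ∀ (hπ : IsSmoothProjectiveFamily π 2), IsQuasiProjectiveOver 𝒳 → IsQuasiProjectiveOver (base W) → AlgebraicGeometry.SmoothOfRelativeDimension (Fintype.card (CIdx e)) (base W).hom → ∀ (hτπ : τ ≫ π = π) (hjπ : j ≫ π =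 π), τ ≫ τ ≫ τ ≫ τ = 𝟙 𝒳 → j ≫ j = τ ≫ τ → τ ≫ j ≫ τ = j → IsOpenImmersion ι → ι ≫ π.left = (snd (deckChart (fun i => (MvPolynomial.X i : ParamRing e))) (Over.mk W.ι)).left → ((Over.isoMk ((deckAction (fun i => (MvPolynomial.X i : ParamRing e))).aut (QuaternionGroup.a 1)) ((deckAction (fun i => (MvPolynomial.X i : ParamRing e))).aut_comp (QuaternionGroup.a 1))).hom ▷ Over.mk W.ι).left ≫ ι = ι ≫ τ.left → ((Over.isoMk ((deckAction (fun i => (MvPolynomial.X i : ParamRing e))).aut (QuaternionGroup.xa 0)) ((deckAction (fun i => (MvPolynomial.X i : ParamRing e))).aut_comp (QuaternionGroup.xa 0))).hom ▷ Over.mk W.ι).left ≫ ι = ι ≫ j.left → Function.Surjective (snd (deckChart (fun i => (MvPolynomial.X i : ParamRing e))) (Over.mk W.ι)).left → ∀ (hU : IsCohomologicallyLocallyTrivialOn π Set.univ), ∃ s : ComplexPoints (base W), Nonempty (GeometricMonodromyDatum π hτπ hjπ hπ hU s)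

end Summit.HodgeConjecture.HodgeConjecture.Theorems.Q8SymplecticPowersLoc6Defs

end
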